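import Mathlib

/-! # `Balaban1983to89.B9Eq323Ker` — B9 (3.3)/(3.19)/(3.23): the kernel of the Dirichlet covariant Laplacian and of
the block averages on covariantly constant functions — the lattice input behind "obvious" in Theorem 3.11, kernel-checked

CITATION HEADER.  Paper sub-cell `b2b-balaban-b09` (gen 6, journal claim SHARPEN T06.1 (3.23) Dirichlet covariant
Laplacian kernel pass 10 ∕ C-B9-31-KER, cell pub-balaban; v1.1 = gen-7 DOCFIX G-pv03-11: docstring only, every declaration
byte-identical to v1 p181216) on T. Balaban, *Propagators for lattice gauge theories in a
background field*, Commun. Math. Phys. 99 (1985) 389–434 [`Balaban1985BackgroundPropagators`] (= B9), pp. 390, 393,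
394, 416 [PDF 2, 5, 6, 28] (renders `b2b-balaban-ref1/pages/1985-cmp99-background-propagators/…-p002-x2.png`,
`…-p005-x2.png`, `…-p006-x2.png`, `…-p028-x2.png`, read as images this session).

WHAT IS PRINTED (verbatim).
* p. 390: *"Let us recall that R(U)X = UXU^{−1}."* … *"Let us introduce covariant derivatives. For a matrix valued
  function A defined at points of the lattice we put (D^η_{U₀}A)(b) = η^{−1}(R(U₀(b))A(b₊) − A(b₋)),"* [p. 391] *"or
  (D^η_{U₀,μ}A)(x) = (D^η_{U₀}A)(x, x + ηe_μ), μ = 1,…,d. (3.3)"*.  (Below we write λ for the printed A, as the paper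
  itself does for 𝔤-valued functions from (3.17) on, and ⟨x, x′⟩ for the bond the print denotes (x, x′); docstring
  corrected in v1.1 per GAPS G-pv03-11 — the v1 header had λ and ⟨·,·⟩ inside the quotation marks.)
* p. 393, (3.19): *"(Q′(V)λ)(y) = Σ_{x∈B(y)} L^{−d}R(V(Γ_{y,x}))λ(x), (Q′_j(U)λ)(y) = (Q′(Ū^{j−1})·…·Q′(Ū)Q′(U)λ)(y) =
  Σ_{x∈B^j(y)} L^{−jd}R(U(Γ^{(j)}_{y,x}))λ(x), y ∈ T^{(j)}_{L^jη}."*  *"The contours Γ^{(j)}_{y,x}, x ∈ B^j(y), and the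
  contour variables U(Γ^{(j)}_{y,x}) were defined by (52), (53) in [5]."*  p. 393: *"we have Ω₀ ⊃ Ω₁ ⊃ ⋯ ⊃ Ω_k, Ω_j ⊂ T_η,
  and we define Λ_j = Ω_j^{(j)} \ Ω_{j+1}^{(j)}, j = 0,1,…,k, Ω_{k+1} = ∅, or Ω_j \ Ω_{j+1} = B^j(Λ_j)"*; *"We have
  introduced the domain Ω₀ because we will consider operators with Dirichlet boundary conditions on Ω₀^c."*; (3.18)
  *"(Q′λ)(y) = (Q′_j(U)λ)(y) for y ∈ Λ_j"*, Q′λ defined on 𝔅 = ⋃_{j=0}^{k} Λ_j.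
* p. 394: *"Δ^η_U = D^η\*_U D^η_U = Σ_{μ=1}^{d} D^η\*_{U,μ}D^η_{U,μ}. (3.23)"* … *"The operator Δ^η_U↾Ω₀ is the covariant
  Laplace operator with Dirichlet boundary conditions on Ω₀^c. Let us elaborate this point a little bit more. By the
  definition of space N(Q′) the functions λ in (3.22) vanish on Ω₁^c. … We will use only Dirichlet boundary conditions.
  … For such Ω₀ we consider the operator Δ′_a with Dirichlet boundary conditions on ∂Ω₀, i.e. the operator Δ′_a↾Ω₀ =
  Ω₀Δ′_aΩ₀. In the last expression Ω₀ denotes a characteristic function of Ω₀, Its inverse is denoted by G′, or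
  G′(U)."*
* p. 416, Theorem 3.11: *"the operators Δ′_a, G′, (Q′G′²Q′\*)^{−1}, Δ_a, G are positive definite. This is obvious for
  the first three operators"*.

WHY THIS FILE.  Pass 9 (`B9Thm311Data`, C-B9-30) constructed the (3.25) data from Δ′_a > 0 and located the only
geometric input of "obvious": the KERNEL CONDITION `hker : ⟨λ, Δ^η_U λ⟩ = 0 → Q′λ = 0 → λ = 0` (there a named
hypothesis).  This file proves that condition from the printed definitions (3.3), (3.19), (3.23) over an abstract site
set, i.e. it certifies the lattice fact itself: a function annihilated by the Dirichlet covariant Laplacian is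
covariantly constant ("flat"), a flat function vanishing at one site of a connected set vanishes (Dirichlet case), and —
with no boundary at all — a flat function with vanishing block averages (3.19) vanishes, because parallel transport of a
flat function along the contour Γ_{y,x} returns its value at y.

TYPING.  `X` = lattice sites (T_η, or Ω₀ with its exterior neighbours), `V` = the fibre (𝔤: a real vector space; the
hermitian-matrix structure is not needed), `τ x x' : V →ₗ[ℝ] V` = R(U(⟨x, x'⟩)) (injective: R(U)X = UXU^{−1}),
`covD τ λ x x'` = R(U(b))λ(b₊) − λ(b₋) for b = ⟨x, x'⟩ = ⟨b₋, b₊⟩ (the factor η^{−1} of (3.3) is dropped — irrelevant for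
kernels), `adj` = the bond relation, `Flat adj τ λ` = "D^η_U λ = 0 on every bond", `Linked adj` = connectedness through
bonds (either orientation), `pathTr τ p` = R(U(Γ)) for a contour Γ written as its list of sites p = [y, …, x]
(transport from the END of the list to its head), `avgQ τ w B Γ λ y` = Σ_{x∈B(y)} w(y,x)·R(U(Γ_{y,x}))λ(x) = (3.19) with
w = L^{−jd}.  The (3.23) identity ⟨λ, Δ^η_U↾Ω₀ λ⟩ = ‖D^η_U(Ω₀λ)‖² = Σ_b η^d|(D^η_U Ω₀λ)(b)|² (definition of the adjoint;
the sum runs over ALL bonds of T_η, Ω₀λ = λ extended by zero) is the dictionary under which `flat_of_sum_sq_eq_zero`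
reads "⟨λ, Δ^η_U λ⟩ = 0 ⇒ λ flat"; it is not re-derived here.

WHAT THIS FILE CERTIFIES (kernel, zero sorry; [folklore] finite-dimensional / combinatorial linear algebra; value =
the lattice input of Theorem 3.11's "obvious" clause and of pass 9's `hker`, NOT summit progress).
1. `covD`, `covD_eq_zero_iff`; zero propagation across one bond in both directions (`eq_zero_of_covD_fwd` needs τ
   injective, `eq_zero_of_covD_bwd` does not).
2. `flat_of_sum_sq_eq_zero` — (3.23): Σ_b c_b‖(Dλ)(b)‖² = 0 with c_b > 0 forces Dλ = 0 on every bond, i.e. ⟨λ, Δλ⟩ = 0 ⇒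
   λ flat; `sum_sq_eq_zero_of_flat` (converse).
3. `flat_zero_of_linked` — a flat λ vanishing at x vanishes at every site linked to x; `dirichlet_kernel` — THE DIRICHLET
   CASE: flat + λ(x₀) = 0 for one site + connectedness ⇒ λ = 0; `dirichlet_kernel_support` — the printed form: λ
   supported in Ω₀ ≠ X (Ω₀λ, "Dirichlet boundary conditions on Ω₀^c"), X connected, D(Ω₀λ) = 0 ⇒ λ = 0.
4. `pathTr`, `pathTr_injective`, `pathTr_flat` — transport of a flat λ along a bond path [y, …, x] sends λ(x) to λ(y)
   (R(U(Γ_{y,x}))λ(x) = λ(y)).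
5. `avgQ`, `avgQ_of_flat` — (3.19) on a flat λ: (Q′λ)(y) = (Σ_{x∈B(y)} w(y,x))·λ(y) (= λ(y) for the printed weights,
   `avgQ_of_flat_of_sum_one`); `kernel_of_flat_of_avgQ` — THE AVERAGING CASE (no boundary needed): flat + Q′λ = 0 on all
   centres + every site lies in some block ⇒ λ = 0; `hker_323` — the pass-9 shape: Σ_b c_b‖Dλ(b)‖² = 0 → Q′λ = 0 → λ = 0.
NOT HERE: the concrete torus T_η / blocks B^j(y) / contours (52)–(53) of [5] (any site set, block system and contour
system satisfying the stated hypotheses — contours are bond paths from y ending at x, blocks cover the sites, weights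
have non-zero sum — is allowed, which only generalises), the identification of Σ_b c_b‖Dλ(b)‖² with ⟨λ, Δ^η_U λ⟩ (the
(3.23) adjoint, dictionary above), uniform lower bounds (Theorems 3.1–3.10), Q′\* injectivity (pass 9's other lattice
input `hqs`).  Cell records: GAPS C-B9-31, DIVERGENCE D-b09.22. -/

namespace Literature.MathematicalPhysics.QuantumFieldTheory.Balaban1983to89.B9Eq323Ker

open scoped BigOperators

variable {X : Type*} {V : Type*}

/-! ## §1  (3.3): the covariant difference and zero propagation across a bond -/

section CovD

variable [AddCommGroup V] [Module ℝ V]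

/-- **(3.3)** up to the factor η^{−1}: (Dλ)(⟨x, x'⟩) = R(U(⟨x, x'⟩))λ(x') − λ(x), with τ x x' = R(U(⟨x, x'⟩)).
[cite: Balaban1985BackgroundPropagators, (3.3) p.390-391] -/
def covD (τ : X → X → V →ₗ[ℝ] V) (l : X → V) (x x' : X) : V := τ x x' (l x') - l x

/-- Unfolding of `covD`. [folklore] -/
theorem covD_apply (τ : X → X → V →ₗ[ℝ] V) (l : X → V) (x x' : X) : covD τ l x x' = τ x x' (l x') - l x := rfl

/-- (Dλ)(b) = 0 iff R(U(b))λ(b₊) = λ(b₋) ("covariantly constant across b"). [folklore] -/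
theorem covD_eq_zero_iff (τ : X → X → V →ₗ[ℝ] V) (l : X → V) (x x' : X) :
    covD τ l x x' = 0 ↔ τ x x' (l x') = l x := sub_eq_zero

/-- "Flat": D^η_U λ = 0 on every bond of the relation `adj`. [cite: Balaban1985BackgroundPropagators, (3.3) p.390, (3.23) p.394] -/
def Flat (adj : X → X → Prop) (τ : X → X → V →ₗ[ℝ] V) (l : X → V) : Prop :=
  ∀ x x' : X, adj x x' → covD τ l x x' = 0

/-- Zero propagates backwards across a flat bond: λ(b₊) = 0 ⇒ λ(b₋) = 0. [folklore] -/
theorem eq_zero_of_covD_bwd {τ : X → X → V →ₗ[ℝ] V} {l : X → V} {x x' : X} (h : covD τ l x x' = 0)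
    (hx' : l x' = 0) : l x = 0 := by
  rw [covD_eq_zero_iff] at h
  rw [← h, hx', map_zero]

/-- Zero propagates forwards across a flat bond when R(U(b)) is injective: λ(b₋) = 0 ⇒ λ(b₊) = 0. [folklore] -/
theorem eq_zero_of_covD_fwd {τ : X → X → V →ₗ[ℝ] V} {l : X → V} {x x' : X} (h : covD τ l x x' = 0)
    (hinj : Function.Injective (τ x x')) (hx : l x = 0) : l x' = 0 := by
  rw [covD_eq_zero_iff] at h
  apply hinj
  rw [map_zero, h, hx]

/-! ## §2  Connectedness: the Dirichlet case -/

/-- Sites linked through bonds of `adj`, in either orientation (lattice connectedness). [folklore] -/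
def Linked (adj : X → X → Prop) : X → X → Prop := Relation.ReflTransGen (fun a b => adj a b ∨ adj b a)

/-- A flat λ vanishing at x vanishes at every site linked to x. [folklore] -/
theorem flat_zero_of_linked {adj : X → X → Prop} {τ : X → X → V →ₗ[ℝ] V} {l : X → V} (hflat : Flat adj τ l)
    (hinj : ∀ x x' : X, adj x x' → Function.Injective (τ x x')) {x y : X} (hxy : Linked adj x y) (hx : l x = 0) :
    l y = 0 := by
  induction hxy with
  | refl => exact hx
  | tail _ hab ih =>
    rcases hab with h | h
    · exact eq_zero_of_covD_fwd (hflat _ _ h) (hinj _ _ h) ih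
    · exact eq_zero_of_covD_bwd (hflat _ _ h) ih

/-- **THE DIRICHLET CASE.** A flat λ that vanishes at one site x₀ to which every site is linked vanishes identically.
[cite: Balaban1985BackgroundPropagators, p.394 ("covariant Laplace operator with Dirichlet boundary conditions on Ω₀^c")] -/
theorem dirichlet_kernel {adj : X → X → Prop} {τ : X → X → V →ₗ[ℝ] V} {l : X → V} (hflat : Flat adj τ l)
    (hinj : ∀ x x' : X, adj x x' → Function.Injective (τ x x')) (x₀ : X) (hx₀ : l x₀ = 0)
    (hconn : ∀ y : X, Linked adj x₀ y) : l = 0 :=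
  funext fun y => flat_zero_of_linked hflat hinj (hconn y) hx₀

/-- The printed form: λ supported in Ω₀ ("Δ′_a↾Ω₀ = Ω₀Δ′_aΩ₀ … Ω₀ denotes a characteristic function of Ω₀"), Ω₀ ≠ the
whole (connected) site set, and D(Ω₀λ) = 0 on every bond ⇒ λ = 0.
[cite: Balaban1985BackgroundPropagators, p.394] -/
theorem dirichlet_kernel_support {adj : X → X → Prop} {τ : X → X → V →ₗ[ℝ] V} {l : X → V} (Ω₀ : Set X)
    (hsupp : ∀ x, x ∉ Ω₀ → l x = 0) (hne : ∃ x₀, x₀ ∉ Ω₀) (hconn : ∀ x y : X, Linked adj x y)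
    (hinj : ∀ x x' : X, adj x x' → Function.Injective (τ x x')) (hflat : Flat adj τ l) : l = 0 := by
  obtain ⟨x₀, hx₀⟩ := hne
  exact dirichlet_kernel hflat hinj x₀ (hsupp x₀ hx₀) (hconn x₀)

/-! ## §3  Transport along a contour: R(U(Γ_{y,x}))λ(x) = λ(y) for flat λ -/

/-- R(U(Γ)) for a contour Γ written as its list of sites [y, x₁, …, x]: the composite τ_{y x₁} ∘ τ_{x₁ x₂} ∘ ⋯, i.e. the
transport from the END of the list to its head. [cite: Balaban1985BackgroundPropagators, (3.19) p.393] -/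
def pathTr (τ : X → X → V →ₗ[ℝ] V) : List X → V →ₗ[ℝ] V
  | [] => LinearMap.id
  | [_] => LinearMap.id
  | x :: x' :: rest => τ x x' ∘ₗ pathTr τ (x' :: rest)

/-- `pathTr` on the empty path. [folklore] -/
theorem pathTr_nil (τ : X → X → V →ₗ[ℝ] V) : pathTr τ [] = LinearMap.id := rfl

/-- `pathTr` on a one-site path. [folklore] -/
theorem pathTr_singleton (τ : X → X → V →ₗ[ℝ] V) (x : X) : pathTr τ [x] = LinearMap.id := rfl

/-- `pathTr` peels off its first bond. [folklore] -/
theorem pathTr_cons_cons (τ : X → X → V →ₗ[ℝ] V) (x x' : X) (rest : List X) :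
    pathTr τ (x :: x' :: rest) = τ x x' ∘ₗ pathTr τ (x' :: rest) := rfl

/-- R(U(Γ)) is injective (a composite of the injective R(U(b))). [folklore] -/
theorem pathTr_injective {τ : X → X → V →ₗ[ℝ] V} (hinj : ∀ x x' : X, Function.Injective (τ x x')) :
    ∀ p : List X, Function.Injective (pathTr τ p)
  | [] => fun a b h => by simpa [pathTr] using h
  | [x] => fun a b h => by simpa [pathTr] using h
  | x :: x' :: rest => by
    intro a b h
    rw [pathTr_cons_cons, LinearMap.comp_apply, LinearMap.comp_apply] at h
    exact pathTr_injective hinj (x' :: rest) (hinj x x' h)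

/-- **Transport of a flat function along a bond path returns its value at the head**: for a path [y, …, x] whose
consecutive sites are bonds, R(U(Γ_{y,x}))λ(x) = λ(y). [folklore] -/
theorem pathTr_flat {adj : X → X → Prop} {τ : X → X → V →ₗ[ℝ] V} {l : X → V} (hflat : Flat adj τ l) :
    ∀ (y : X) (rest : List X), List.IsChain adj (y :: rest) →
      pathTr τ (y :: rest) (l ((y :: rest).getLast (List.cons_ne_nil y rest))) = l y
  | y, [], _ => by simp [pathTr]
  | y, x' :: rest, hc => by
    rw [List.isChain_cons_cons] at hc
    rw [pathTr_cons_cons, LinearMap.comp_apply, List.getLast_cons_cons, pathTr_flat hflat x' rest hc.2]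
    exact (covD_eq_zero_iff τ l y x').mp (hflat y x' hc.1)

/-! ## §4  (3.19) on flat functions: the averaging case (no boundary needed) -/

variable {Y : Type*}

/-- **(3.19)** abstractly: (Q′λ)(y) = Σ_{x∈B(y)} w(y,x)·R(U(Γ_{y,x}))λ(x), the contour Γ_{y,x} given as the list of sites
AFTER y (so the path is y :: Γ y x, ending at x). [cite: Balaban1985BackgroundPropagators, (3.19) p.393] -/
def avgQ (τ : X → X → V →ₗ[ℝ] V) (w : Y → X → ℝ) (B : Y → Finset X) (Γ : Y → X → List X) (l : X → V) (y : Y → X)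
    (c : Y) : V :=
  ∑ x ∈ B c, w c x • pathTr τ (y c :: Γ c x) (l x)

/-- (3.19) on a FLAT λ: every transported term equals λ(y), so (Q′λ)(y) = (Σ_{x∈B(y)} w(y,x))·λ(y).
[cite: Balaban1985BackgroundPropagators, (3.19) p.393] -/
theorem avgQ_of_flat {adj : X → X → Prop} {τ : X → X → V →ₗ[ℝ] V} {l : X → V} (hflat : Flat adj τ l)
    (w : Y → X → ℝ) (B : Y → Finset X) (Γ : Y → X → List X) (y : Y → X) (c : Y)
    (hchain : ∀ x ∈ B c, List.IsChain adj (y c :: Γ c x))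
    (hlast : ∀ x ∈ B c, (y c :: Γ c x).getLast (List.cons_ne_nil _ _) = x) :
    avgQ τ w B Γ l y c = (∑ x ∈ B c, w c x) • l (y c) := by
  rw [avgQ, Finset.sum_smul]
  refine Finset.sum_congr rfl fun x hx => ?_
  congr 1
  have h := pathTr_flat hflat (y c) (Γ c x) (hchain x hx)
  rwa [hlast x hx] at h

/-- With the printed weights (Σ_{x∈B^j(y)} L^{−jd} = 1): (Q′λ)(y) = λ(y) for flat λ. [cite: Balaban1985BackgroundPropagators, (3.19) p.393] -/
theorem avgQ_of_flat_of_sum_one {adj : X → X → Prop} {τ : X → X → V →ₗ[ℝ] V} {l : X → V} (hflat : Flat adj τ l)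
    (w : Y → X → ℝ) (B : Y → Finset X) (Γ : Y → X → List X) (y : Y → X) (c : Y)
    (hchain : ∀ x ∈ B c, List.IsChain adj (y c :: Γ c x))
    (hlast : ∀ x ∈ B c, (y c :: Γ c x).getLast (List.cons_ne_nil _ _) = x) (hw : ∑ x ∈ B c, w c x = 1) :
    avgQ τ w B Γ l y c = l (y c) := by
  rw [avgQ_of_flat hflat w B Γ y c hchain hlast, hw, one_smul]

/-- **THE AVERAGING CASE.** A flat λ with (Q′λ)(y) = 0 at every centre vanishes identically, provided every site lies
in some block, contours are bond paths from the centre ending at the site, the weights of each block have non-zero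
sum, and the transports are injective — no boundary condition is needed ("By the definition of space N(Q′) the
functions λ … vanish", here for flat λ on all of X). [cite: Balaban1985BackgroundPropagators, (3.19) p.393, p.394, Thm 3.11 p.416] -/
theorem kernel_of_flat_of_avgQ {adj : X → X → Prop} {τ : X → X → V →ₗ[ℝ] V} {l : X → V} (hflat : Flat adj τ l)
    (hinj : ∀ x x' : X, Function.Injective (τ x x')) (w : Y → X → ℝ) (B : Y → Finset X) (Γ : Y → X → List X)
    (y : Y → X) (hchain : ∀ c, ∀ x ∈ B c, List.IsChain adj (y c :: Γ c x))
    (hlast : ∀ c, ∀ x ∈ B c, (y c :: Γ c x).getLast (List.cons_ne_nil _ _) = x) (hw : ∀ c, ∑ x ∈ B c, w c x ≠ 0)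
    (hcover : ∀ x : X, ∃ c : Y, x ∈ B c) (havg : ∀ c : Y, avgQ τ w B Γ l y c = 0) : l = 0 := by
  funext x
  obtain ⟨c, hx⟩ := hcover x
  have hyc : l (y c) = 0 := by
    have h := havg c
    rw [avgQ_of_flat hflat w B Γ y c (hchain c) (hlast c)] at h
    exact (smul_eq_zero.mp h).resolve_left (hw c)
  have ht := pathTr_flat hflat (y c) (Γ c x) (hchain c x hx)
  rw [hlast c x hx, hyc] at ht
  exact pathTr_injective hinj (y c :: Γ c x) (by rw [ht, Pi.zero_apply, map_zero])

end CovD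

/-! ## §5  (3.23): ⟨λ, Δλ⟩ = ‖Dλ‖² = 0 forces flatness; the pass-9 hypothesis shape -/

section Norm

variable [NormedAddCommGroup V] [NormedSpace ℝ V]

/-- **(3.23)**: if ‖D^η_U λ‖² = Σ_{b} c_b‖(Dλ)(b)‖² vanishes (c_b > 0 the printed weights η^d), then Dλ = 0 on every
bond: ⟨λ, Δ^η_U λ⟩ = 0 ⇒ λ flat. [cite: Balaban1985BackgroundPropagators, (3.23) p.394] -/
theorem flat_of_sum_sq_eq_zero (τ : X → X → V →ₗ[ℝ] V) (l : X → V) (bonds : Finset (X × X)) (c : X × X → ℝ)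
    (hc : ∀ b ∈ bonds, 0 < c b) (h : ∑ b ∈ bonds, c b * ‖covD τ l b.1 b.2‖ ^ 2 = 0) :
    Flat (fun x x' => (x, x') ∈ bonds) τ l := by
  intro x x' hb
  have hnn : ∀ b ∈ bonds, 0 ≤ c b * ‖covD τ l b.1 b.2‖ ^ 2 := fun b hb' => by
    have := hc b hb'
    positivity
  have h1 := (Finset.sum_eq_zero_iff_of_nonneg hnn).mp h (x, x') hb
  rcases mul_eq_zero.mp h1 with h2 | h2
  · exact absurd h2 (hc _ hb).ne'
  · simpa using h2

/-- Converse: a flat λ has ‖Dλ‖² = 0. [folklore] -/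
theorem sum_sq_eq_zero_of_flat (τ : X → X → V →ₗ[ℝ] V) (l : X → V) (bonds : Finset (X × X)) (c : X × X → ℝ)
    (h : Flat (fun x x' => (x, x') ∈ bonds) τ l) : ∑ b ∈ bonds, c b * ‖covD τ l b.1 b.2‖ ^ 2 = 0 := by
  refine Finset.sum_eq_zero fun b hb => ?_
  rw [h b.1 b.2 hb, norm_zero]
  simp

variable {Y : Type*}

/-- **THE PASS-9 HYPOTHESIS SHAPE** (`B9Thm311Data.lapA_posDef_of`'s `hker`, at this typing): ‖D^η_U λ‖² = 0 → Q′λ = 0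
→ λ = 0, from (3.3), (3.19), (3.23) — for any block/contour system whose contours are bond paths from the centre ending
at the site, whose blocks cover the sites and whose block weights have non-zero sum, with injective transports.
[cite: Balaban1985BackgroundPropagators, (3.23) p.394, (3.19) p.393, Thm 3.11 p.416] -/
theorem hker_323 (τ : X → X → V →ₗ[ℝ] V) (hinj : ∀ x x' : X, Function.Injective (τ x x'))
    (bonds : Finset (X × X)) (cb : X × X → ℝ) (hcb : ∀ b ∈ bonds, 0 < cb b) (w : Y → X → ℝ) (B : Y → Finset X)
    (Γ : Y → X → List X) (y : Y → X)
    (hchain : ∀ c, ∀ x ∈ B c, List.IsChain (fun a a' => (a, a') ∈ bonds) (y c :: Γ c x))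
    (hlast : ∀ c, ∀ x ∈ B c, (y c :: Γ c x).getLast (List.cons_ne_nil _ _) = x) (hw : ∀ c, ∑ x ∈ B c, w c x ≠ 0)
    (hcover : ∀ x : X, ∃ c : Y, x ∈ B c) (l : X → V)
    (hD : ∑ b ∈ bonds, cb b * ‖covD τ l b.1 b.2‖ ^ 2 = 0) (hQ : ∀ c : Y, avgQ τ w B Γ l y c = 0) : l = 0 :=
  kernel_of_flat_of_avgQ (flat_of_sum_sq_eq_zero τ l bonds cb hcb hD) hinj w B Γ y hchain hlast hw hcover hQ

/-- And the Dirichlet shape: ‖D(Ω₀λ)‖² = 0 over a connected site set with a site outside Ω₀ ⇒ λ = 0.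
[cite: Balaban1985BackgroundPropagators, (3.23) p.394, p.394 (Dirichlet boundary conditions on Ω₀^c)] -/
theorem hker_323_dirichlet (τ : X → X → V →ₗ[ℝ] V) (bonds : Finset (X × X))
    (hinj : ∀ x x' : X, (x, x') ∈ bonds → Function.Injective (τ x x')) (cb : X × X → ℝ)
    (hcb : ∀ b ∈ bonds, 0 < cb b) (Ω₀ : Set X) (hne : ∃ x₀, x₀ ∉ Ω₀)
    (hconn : ∀ x x' : X, Linked (fun a a' => (a, a') ∈ bonds) x x') (l : X → V) (hsupp : ∀ x, x ∉ Ω₀ → l x = 0)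
    (hD : ∑ b ∈ bonds, cb b * ‖covD τ l b.1 b.2‖ ^ 2 = 0) : l = 0 :=
  dirichlet_kernel_support Ω₀ hsupp hne hconn hinj (flat_of_sum_sq_eq_zero τ l bonds cb hcb hD)

end Norm

end Literature.MathematicalPhysics.QuantumFieldTheory.Balaban1983to89.B9Eq323Ker
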